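import Mathlib

/-!
# FaceTheoremCores — the linear-algebra cores of the FACE THEOREM of the 3-D sharp-interface class
# (STAGING; nogo gen 25; `SIEVELD.md` §3.4b (8) (F), cases (α) 'closed flat cylinder' and (β) 'rational 2-torus',
# and (E′) 'free edges are pure stretching lines')

search for candidate a priori estimates; no regularity claim.

Setting of SIEVELD §3.4b (8) (gen 13, pen): a finite polyhedral `𝒦`-configuration is a Lipschitz periodic
`u : 𝕋³ → ℝ³` with `∇u ≡ A_c` constant on finitely many cells, `sym A_c = K_c := I − 3 n_c ⊗ n_c` (`|n_c| = 1`).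
The FACE THEOREM (F) says that every face has a charged edge; its proof reduces, through the free-edge
criterion (E), to a face `F` of a cell `c` all of whose boundary edges are parallel to `d := n_c × N_F`, which is
then either (α) a closed flat cylinder — so a lattice vector `v ∥ d`, `v ≠ 0`, `v ⊥ n_c`, satisfies `A_c v = 0`
(periodicity of `u` along the translated closed line) — or (β) an entire rational 2-torus — so the quadratic form
`|v|²/3 − (n_c·v)²` vanishes on three pairwise non-parallel lattice vectors of one plane.  THIS FILE proves, as
pure linear algebra over `ℝ` (any finite index type `d` for (α), `Fin 3`-free statements throughout), exactly the
two contradictions and the (E′) identity: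

* `loop_vector_eq_zero` (case (α)): if `A = (1 − 3 n⊗n) + W` with `Wᵀ = −W` (a constant gradient whose symmetric
  part is the well `K(n)`), `n·v = 0` and `A v = 0`, then `v = 0` — because `vᵀA v = vᵀK(n)v = |v|² − 3(n·v)² =
  |v|²`.  So no non-zero period `v ⊥ n_c` can close up inside the cell: the cylinder face is impossible.
* `dotProduct_well_mulVec_of_orthogonal` ((E′)): `n·τ = 0 ⇒ τᵀ(1 − 3 n⊗n)τ = |τ|²` — along a free edge (every
  incident director `⊥ τ` by (E)) each incident cell stretches the edge direction at unit rate.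
* `binaryForm_eq_zero_of_three_roots` [folklore]: a real binary quadratic form `α s² + β s t + γ t²` vanishing at
  three pairwise non-proportional points `(sᵢ, tᵢ)` is zero (`α = β = γ = 0`; Cramer with the Vandermonde-type
  determinant `∏ (sᵢtⱼ − sⱼtᵢ)`).
* `wellForm_plane_not_identically_zero`: for `a, b` spanning a plane (concretely: `s•a + t•b = 0 ⇒ s = t = 0`) the
  form `q_n(v) := |v|² − 3(n·v)²` (three times the form of (β)) is NOT identically zero on the plane — the plane
  contains `v ≠ 0` with `n·v = 0`, where `q_n(v) = |v|² ≠ 0`.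
* `no_three_root_lines` (case (β)): hence `q_n` cannot vanish on three pairwise non-parallel vectors
  `sᵢ•a + tᵢ•b` of the plane: the torus face is impossible.
NOT in Lean here: the polyhedral/measure-theoretic part of (F) (faces, free-edge criterion (E), the reduction to
(α)/(β)), the mirror law (staged elsewhere: `SharpClass.DirectorForm.mirror_jump`), anything about mollified
fields, D₀, or Navier–Stokes.  No verdict of the cell changes.  [ours = the assembly; folklore = the algebra]
-/

noncomputable section

open Matrix

namespace Summit.NavierStokesRegularity.FunctionalMining.SharpClass.FaceCores

variable {d : Type*} [Fintype d] [DecidableEq d]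

omit [DecidableEq d] in
/-- `(a ⊗ b) v = (b·v) a`. [folklore] -/
theorem vecMulVec_mulVec_eq_smul (a b v : d → ℝ) : vecMulVec a b *ᵥ v = (b ⬝ᵥ v) • a := by
  ext i
  simp only [Matrix.mulVec, dotProduct, vecMulVec_apply, Pi.smul_apply, smul_eq_mul]
  rw [Finset.sum_mul]
  exact Finset.sum_congr rfl fun j _ => by ring

/-- The well `K(n) = 1 − 3 n⊗n` acts on vectors orthogonal to the director as the identity:
`n·v = 0 ⇒ (1 − 3 n⊗n) v = v`. [ours] -/
theorem well_mulVec_of_orthogonal {n v : d → ℝ} (hnv : n ⬝ᵥ v = 0) :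
    (1 - (3 : ℝ) • vecMulVec n n) *ᵥ v = v := by
  rw [Matrix.sub_mulVec, Matrix.one_mulVec, Matrix.smul_mulVec, vecMulVec_mulVec_eq_smul, hnv,
    zero_smul, smul_zero, sub_zero]

/-- (E′) of SIEVELD §3.4b (8): along a direction `τ` orthogonal to the director, the well stretches at unit rate,
`τᵀ K(n) τ = |τ|²` (so `= 1` for a unit tangent: free edges are pure stretching lines). [ours] -/
theorem dotProduct_well_mulVec_of_orthogonal {n τ : d → ℝ} (hnτ : n ⬝ᵥ τ = 0) :
    τ ⬝ᵥ (1 - (3 : ℝ) • vecMulVec n n) *ᵥ τ = τ ⬝ᵥ τ := by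
  rw [well_mulVec_of_orthogonal hnτ]

omit [DecidableEq d] in
/-- An antisymmetric matrix has vanishing quadratic form: `Wᵀ = −W ⇒ vᵀ W v = 0`. [folklore] -/
theorem dotProduct_mulVec_self_of_antisymm {W : Matrix d d ℝ} (hW : Wᵀ = -W) (v : d → ℝ) :
    v ⬝ᵥ W *ᵥ v = 0 := by
  have h1 : v ⬝ᵥ W *ᵥ v = (Wᵀ *ᵥ v) ⬝ᵥ v := by
    rw [Matrix.dotProduct_mulVec, Matrix.mulVec_transpose]
  rw [hW, Matrix.neg_mulVec, neg_dotProduct, dotProduct_comm (W *ᵥ v) v] at h1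
  linarith

/-- CASE (α) OF THE FACE THEOREM (the closed flat cylinder is impossible).  Let the constant gradient of a cell be
`A = K(n) + W`, `K(n) = 1 − 3 n⊗n`, `Wᵀ = −W`.  If a vector `v` with `n·v = 0` satisfies `A v = 0` (periodicity of
`u` along a closed line of direction `v` inside the cell), then `v = 0` — since `0 = vᵀA v = vᵀK(n)v = |v|²`.
[ours] -/
theorem loop_vector_eq_zero {n v : d → ℝ} {W : Matrix d d ℝ} (hW : Wᵀ = -W) (hnv : n ⬝ᵥ v = 0)
    (hAv : (1 - (3 : ℝ) • vecMulVec n n + W) *ᵥ v = 0) : v = 0 := by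
  have h1 : v ⬝ᵥ (1 - (3 : ℝ) • vecMulVec n n + W) *ᵥ v = 0 := by rw [hAv, dotProduct_zero]
  rw [Matrix.add_mulVec, dotProduct_add, well_mulVec_of_orthogonal hnv,
    dotProduct_mulVec_self_of_antisymm hW, add_zero] at h1
  exact dotProduct_self_eq_zero.mp h1

/-- A real binary quadratic form vanishing at three pairwise non-proportional points is zero (Cramer's rule:
the coefficient determinant is `(s₀t₁ − s₁t₀)(s₀t₂ − s₂t₀)(s₁t₂ − s₂t₁)`). [folklore] -/
theorem binaryForm_eq_zero_of_three_roots {α β γ : ℝ} {s t : Fin 3 → ℝ}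
    (h01 : s 0 * t 1 - s 1 * t 0 ≠ 0) (h02 : s 0 * t 2 - s 2 * t 0 ≠ 0) (h12 : s 1 * t 2 - s 2 * t 1 ≠ 0)
    (hroot : ∀ i, α * s i ^ 2 + β * (s i * t i) + γ * t i ^ 2 = 0) : α = 0 ∧ β = 0 ∧ γ = 0 := by
  have e0 := hroot 0
  have e1 := hroot 1
  have e2 := hroot 2
  have hD : (s 0 * t 1 - s 1 * t 0) * (s 0 * t 2 - s 2 * t 0) * (s 1 * t 2 - s 2 * t 1) ≠ 0 :=
    mul_ne_zero (mul_ne_zero h01 h02) h12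
  have hα : α * ((s 0 * t 1 - s 1 * t 0) * (s 0 * t 2 - s 2 * t 0) * (s 1 * t 2 - s 2 * t 1)) = 0 := by
    linear_combination (t 1 * t 2 * (s 1 * t 2 - s 2 * t 1)) * e0 - (t 0 * t 2 * (s 0 * t 2 - s 2 * t 0)) * e1
      + (t 0 * t 1 * (s 0 * t 1 - s 1 * t 0)) * e2
  have hβ : β * ((s 0 * t 1 - s 1 * t 0) * (s 0 * t 2 - s 2 * t 0) * (s 1 * t 2 - s 2 * t 1)) = 0 := by
    linear_combination (-((s 1 * t 2 - s 2 * t 1) * (s 1 * t 2 + s 2 * t 1))) * e0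
      + ((s 0 * t 2 - s 2 * t 0) * (s 0 * t 2 + s 2 * t 0)) * e1
      - ((s 0 * t 1 - s 1 * t 0) * (s 0 * t 1 + s 1 * t 0)) * e2
  have hγ : γ * ((s 0 * t 1 - s 1 * t 0) * (s 0 * t 2 - s 2 * t 0) * (s 1 * t 2 - s 2 * t 1)) = 0 := by
    linear_combination (s 1 * s 2 * (s 1 * t 2 - s 2 * t 1)) * e0 - (s 0 * s 2 * (s 0 * t 2 - s 2 * t 0)) * e1
      + (s 0 * s 1 * (s 0 * t 1 - s 1 * t 0)) * e2
  exact ⟨(mul_eq_zero.mp hα).resolve_right hD, (mul_eq_zero.mp hβ).resolve_right hD,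
    (mul_eq_zero.mp hγ).resolve_right hD⟩

/-- The face form of case (β), scaled by `3`: `q_n(v) := |v|² − 3 (n·v)² = vᵀ K(n) v`. [ours] -/
def wellForm (n v : d → ℝ) : ℝ := v ⬝ᵥ v - 3 * (n ⬝ᵥ v) ^ 2

omit [DecidableEq d] in
/-- Restriction of `q_n` to the plane `{s•a + t•b}` is the binary form with coefficients `q_n(a)`,
`2(a·b − 3(n·a)(n·b))`, `q_n(b)`. [ours] -/
theorem wellForm_smul_add (n a b : d → ℝ) (s t : ℝ) :
    wellForm n (s • a + t • b) =
      wellForm n a * s ^ 2 + (2 * (a ⬝ᵥ b - 3 * ((n ⬝ᵥ a) * (n ⬝ᵥ b)))) * (s * t) + wellForm n b * t ^ 2 := by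
  simp only [wellForm, dotProduct_add, add_dotProduct, dotProduct_smul, smul_dotProduct, smul_eq_mul,
    dotProduct_comm b a]
  ring

omit [DecidableEq d] in
/-- On a genuine plane (`a`, `b` independent) the form `q_n` is not identically zero: the plane contains a
non-zero vector orthogonal to `n` (namely `(n·b)•a − (n·a)•b`, or `a` itself if `n ⊥ a, b`), on which
`q_n = |v|² ≠ 0`. [ours] -/
theorem wellForm_plane_not_identically_zero {n a b : d → ℝ}
    (hab : ∀ s t : ℝ, s • a + t • b = 0 → s = 0 ∧ t = 0) :
    ¬ (∀ s t : ℝ, wellForm n (s • a + t • b) = 0) := by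
  intro h
  have ha : a ≠ 0 := by
    intro ha0
    have := (hab 1 0 (by rw [ha0, smul_zero, zero_smul, add_zero])).1
    exact one_ne_zero this
  by_cases hn : n ⬝ᵥ a = 0 ∧ n ⬝ᵥ b = 0
  · -- `a` itself is orthogonal to `n`
    have h1 := h 1 0
    rw [one_smul, zero_smul, add_zero, wellForm, hn.1] at h1
    have : a ⬝ᵥ a = 0 := by linarith
    exact ha (dotProduct_self_eq_zero.mp this)
  · -- `v := (n·b)•a − (n·a)•b` is orthogonal to `n` and non-zero
    set v : d → ℝ := (n ⬝ᵥ b) • a + (-(n ⬝ᵥ a)) • b with hv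
    have hnv : n ⬝ᵥ v = 0 := by
      rw [hv, dotProduct_add, dotProduct_smul, dotProduct_smul, smul_eq_mul, smul_eq_mul]; ring
    have h1 := h (n ⬝ᵥ b) (-(n ⬝ᵥ a))
    rw [← hv, wellForm, hnv] at h1
    have hvv : v ⬝ᵥ v = 0 := by linarith
    have hv0 : v = 0 := dotProduct_self_eq_zero.mp hvv
    have hst := hab (n ⬝ᵥ b) (-(n ⬝ᵥ a)) (by rw [← hv]; exact hv0)
    exact hn ⟨neg_eq_zero.mp hst.2, hst.1⟩

omit [DecidableEq d] in
/-- CASE (β) OF THE FACE THEOREM (the rational 2-torus face is impossible).  If `a, b` span a plane, the form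
`q_n(v) = |v|² − 3(n·v)²` cannot vanish on three pairwise non-parallel vectors `sᵢ•a + tᵢ•b` of that plane
(it would vanish identically by `binaryForm_eq_zero_of_three_roots`, contradicting
`wellForm_plane_not_identically_zero`).  In (F)(β) the three vectors are lattice periods of the torus face inside
the cell `c`, for each of which the loop identity gives `(n_c·v)² = |v|²/3`. [ours] -/
theorem no_three_root_lines {n a b : d → ℝ} (hab : ∀ s t : ℝ, s • a + t • b = 0 → s = 0 ∧ t = 0)
    {s t : Fin 3 → ℝ} (h01 : s 0 * t 1 - s 1 * t 0 ≠ 0) (h02 : s 0 * t 2 - s 2 * t 0 ≠ 0)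
    (h12 : s 1 * t 2 - s 2 * t 1 ≠ 0) (hroot : ∀ i, wellForm n (s i • a + t i • b) = 0) : False := by
  have hcoef := binaryForm_eq_zero_of_three_roots (α := wellForm n a)
    (β := 2 * (a ⬝ᵥ b - 3 * ((n ⬝ᵥ a) * (n ⬝ᵥ b)))) (γ := wellForm n b) h01 h02 h12
    (fun i => by rw [← wellForm_smul_add]; exact hroot i)
  refine wellForm_plane_not_identically_zero (n := n) hab fun s' t' => ?_
  rw [wellForm_smul_add, hcoef.1, hcoef.2.1, hcoef.2.2]
  ring

/-- The loop identity of (F) in the form used above: if the constant gradient `A = K(n) + W` (`Wᵀ = −W`) of a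
cell kills a period `v` (`A v = 0`), then `q_n(v) = vᵀ K(n) v = 0`. [ours] -/
theorem wellForm_eq_zero_of_loop {n v : d → ℝ} {W : Matrix d d ℝ} (hW : Wᵀ = -W)
    (hAv : (1 - (3 : ℝ) • vecMulVec n n + W) *ᵥ v = 0) : wellForm n v = 0 := by
  have h1 : v ⬝ᵥ (1 - (3 : ℝ) • vecMulVec n n + W) *ᵥ v = 0 := by rw [hAv, dotProduct_zero]
  rw [Matrix.add_mulVec, dotProduct_add, dotProduct_mulVec_self_of_antisymm hW, add_zero, Matrix.sub_mulVec,
    Matrix.one_mulVec, dotProduct_sub, Matrix.smul_mulVec, dotProduct_smul, vecMulVec_mulVec_eq_smul,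
    dotProduct_smul, smul_eq_mul, smul_eq_mul, dotProduct_comm v n] at h1
  rw [wellForm, ← h1]
  ring

/-- Sanity instance of (α) in `ℝ³` with the director `n = e₃`, `W = 0` and `v = (1, 0, 0) ⊥ n`:
`K(e₃) v = v ≠ 0`, consistent with `loop_vector_eq_zero`. [ours] -/
example : (1 - (3 : ℝ) • vecMulVec ![(0 : ℝ), 0, 1] ![(0 : ℝ), 0, 1]) *ᵥ ![1, 0, 0] = ![1, 0, 0] :=
  well_mulVec_of_orthogonal (by simp [dotProduct, Fin.sum_univ_three])

end Summit.NavierStokesRegularity.FunctionalMining.SharpClass.FaceCores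

end
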